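import Summits.QuantumAdvantage.QuantumAdvantage.Theses.LinnikCubicClassGroups

/-!
# Crux `LinnikCubicClassGroups.PureCubicClassGroupFBQP` (stmt-QuantumAdvantage-11544)

Stub `stub_packing` of the line `arakelov-giant-step-cycle`.

PACKING OF RELATIVE MINIMA IN A DYADIC RANGE: for ANY field `K` with ring homomorphisms
`σ₁ : K → ℝ`, `σ₂ : K → ℂ`, any additive subgroup `L ⊆ K` and any `t`, at most SIX elements
`θ ∈ L ∖ 0` that are relative minima of `L` (no nonzero `φ ∈ L` has `|σ₁ φ| < |σ₁ θ|` and
`‖σ₂ φ‖ < ‖σ₂ θ‖`) have `t ≤ σ₁ θ < 2t`.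

Proof (elementary plane geometry).
* (a) For two such minima `θ ≠ θ'`, `φ := θ - θ' ∈ L ∖ 0` has `|σ₁ φ| < t ≤ |σ₁ θ|`, so minimality
  of `θ` gives `‖σ₂ θ‖ ≤ ‖σ₂ θ - σ₂ θ'‖`, and symmetrically for `θ'`
  (`stub_packing_norm_le_norm_sub`).
* (b) If `‖z‖, ‖z'‖ ≤ ‖z - z'‖` then `2 re (z conj z') ≤ min (‖z‖², ‖z'‖²) ≤ ‖z‖ ‖z'‖`, i.e. the
  angle at `0` between `z` and `z'` is `≥ 60°` (`stub_packing_two_mul_re_le`).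
* (c) The sector index `⌈3 arg z / π⌉ ∈ {-2, …, 3}` cuts `ℂ ∖ 0` into six half-open `60°` sectors;
  two nonzero points with the same index have `|arg z - arg z'| < π / 3`, hence
  `re (z conj z') = ‖z‖ ‖z'‖ cos (arg z - arg z') > ‖z‖ ‖z'‖ / 2` (`stub_packing_lt_two_mul_re`).
* Hence `θ ↦ ⌈3 arg (σ₂ θ) / π⌉` is injective on the set and lands in a `6`-element set of
  integers, so the set has `encard ≤ 6`.
-/

namespace Summit.QuantumAdvantage.QuantumAdvantage.Theorems.LinnikCubicClassGroups

open scoped NumberField Real ComplexConjugate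
open Complex

/-- (a) Two distinct relative minima `θ ≠ θ'` of `L` with real conjugates in the same dyadic range
`[t, 2t)`: the difference `θ - θ'` is a nonzero lattice vector with `|σ₁ (θ - θ')| < t ≤ |σ₁ θ|`, so
minimality of `θ` forces `‖σ₂ θ‖ ≤ ‖σ₂ θ - σ₂ θ'‖`. -/
theorem stub_packing_norm_le_norm_sub {K : Type} [Field K] (σ₁ : K →+* ℝ) (σ₂ : K →+* ℂ)
    (L : AddSubgroup K) (t : ℝ) {θ θ' : K} (hθL : θ ∈ L)
    (hmin : ∀ φ ∈ L, φ ≠ 0 → |σ₁ φ| < |σ₁ θ| → ‖σ₂ θ‖ ≤ ‖σ₂ φ‖)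
    (ht : t ≤ σ₁ θ) (ht2 : σ₁ θ < 2 * t) (hθ'L : θ' ∈ L) (ht' : t ≤ σ₁ θ') (ht2' : σ₁ θ' < 2 * t)
    (hne : θ ≠ θ') : ‖σ₂ θ‖ ≤ ‖σ₂ θ - σ₂ θ'‖ := by
  rw [← map_sub]
  refine hmin _ (L.sub_mem hθL hθ'L) (sub_ne_zero.mpr hne) ?_
  rw [map_sub, abs_sub_lt_iff]
  have : t ≤ |σ₁ θ| := ht.trans (le_abs_self _)
  constructor <;> linarith

/-- (b) Two complex numbers each no longer than their difference make an angle `≥ 60°` at `0`: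
`2 re (z * conj z') ≤ ‖z‖ ‖z'‖`. -/
theorem stub_packing_two_mul_re_le {z z' : ℂ} (h : ‖z‖ ≤ ‖z - z'‖) (h' : ‖z'‖ ≤ ‖z - z'‖) :
    2 * (z * conj z').re ≤ ‖z‖ * ‖z'‖ := by
  have e := Complex.normSq_sub z z'
  simp only [Complex.normSq_eq_norm_sq] at e
  have h1 : ‖z‖ ^ 2 ≤ ‖z - z'‖ ^ 2 := pow_le_pow_left₀ (norm_nonneg _) h 2
  have h2 : ‖z'‖ ^ 2 ≤ ‖z - z'‖ ^ 2 := pow_le_pow_left₀ (norm_nonneg _) h' 2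
  have hz := norm_nonneg z
  have hz' := norm_nonneg z'
  rcases le_total ‖z‖ ‖z'‖ with hle | hle
  · nlinarith [mul_le_mul_of_nonneg_left hle hz]
  · nlinarith [mul_le_mul_of_nonneg_left hle hz']

/-- The cosine form of the real part of `z * conj z'`:
`re (z * conj z') = ‖z‖ ‖z'‖ cos (arg z - arg z')`. -/
theorem stub_packing_re_mul_conj (z z' : ℂ) :
    (z * conj z').re = ‖z‖ * ‖z'‖ * Real.cos (arg z - arg z') := by
  rw [Real.cos_sub, Complex.mul_re, Complex.conj_re, Complex.conj_im]
  linear_combination (-z'.re) * Complex.norm_mul_cos_arg z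
    + (-(‖z‖ * Real.cos (arg z))) * Complex.norm_mul_cos_arg z'
    + (-z'.im) * Complex.norm_mul_sin_arg z
    + (-(‖z‖ * Real.sin (arg z))) * Complex.norm_mul_sin_arg z'

/-- Two angles with the same sector index `⌈3 a / π⌉` differ by less than `π / 3`, so the cosine of
their difference exceeds `1 / 2`. -/
theorem stub_packing_half_lt_cos {a a' : ℝ} (h : ⌈3 * a / π⌉ = ⌈3 * a' / π⌉) :
    1 / 2 < Real.cos (a - a') := by
  have hπ := Real.pi_pos
  have h1 := Int.le_ceil (3 * a / π)
  have h2 := Int.ceil_lt_add_one (3 * a / π)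
  have h3 := Int.le_ceil (3 * a' / π)
  have h4 := Int.ceil_lt_add_one (3 * a' / π)
  rw [h] at h1 h2
  have e1 : (a - a') / (π / 3) = 3 * a / π - 3 * a' / π := by ring
  have e2 : (a' - a) / (π / 3) = 3 * a' / π - 3 * a / π := by ring
  have hd : |a - a'| < π / 3 := abs_sub_lt_iff.mpr
    ⟨(div_lt_one (by positivity)).mp (by rw [e1]; linarith),
     (div_lt_one (by positivity)).mp (by rw [e2]; linarith)⟩
  have hc := Real.cos_lt_cos_of_nonneg_of_le_pi (abs_nonneg (a - a')) (by linarith) hd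
  rwa [Real.cos_pi_div_three, Real.cos_abs] at hc

/-- (c) Two nonzero complex numbers with the same sector index `⌈3 arg / π⌉` make an angle `< 60°`
at `0`: `‖z‖ ‖z'‖ < 2 re (z * conj z')`. -/
theorem stub_packing_lt_two_mul_re {z z' : ℂ} (hz : z ≠ 0) (hz' : z' ≠ 0)
    (h : ⌈3 * arg z / π⌉ = ⌈3 * arg z' / π⌉) : ‖z‖ * ‖z'‖ < 2 * (z * conj z').re := by
  rw [stub_packing_re_mul_conj]
  have hc := stub_packing_half_lt_cos h
  have hp : 0 < ‖z‖ * ‖z'‖ := mul_pos (norm_pos_iff.mpr hz) (norm_pos_iff.mpr hz')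
  have := mul_lt_mul_of_pos_left hc hp
  linarith

/-- The sector index `⌈3 arg z / π⌉` lies in `{-2, …, 3}`, as `arg z ∈ (-π, π]`. -/
theorem stub_packing_sector_mem (z : ℂ) : -2 ≤ ⌈3 * arg z / π⌉ ∧ ⌈3 * arg z / π⌉ ≤ 3 := by
  have hπ := Real.pi_pos
  have h1 := Complex.neg_pi_lt_arg z
  have h2 := Complex.arg_le_pi z
  constructor
  · have : (-3 : ℤ) < ⌈3 * arg z / π⌉ := by
      rw [Int.lt_ceil]
      push_cast
      rw [lt_div_iff₀ hπ]
      linarith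
    omega
  · rw [Int.ceil_le]
    push_cast
    rw [div_le_iff₀ hπ]
    linarith

/-- **S1 `stub_packing`** — packing of relative minima in a dyadic range. For ANY field `K` with
ring homomorphisms `σ₁ : K → ℝ`, `σ₂ : K → ℂ`, any additive subgroup `L ⊆ K` and any `t > 0`: at
most SIX elements `θ ∈ L ∖ 0` that are relative minima of `L` (no nonzero `φ ∈ L` has both
`|σ₁ φ| < |σ₁ θ|` and `‖σ₂ φ‖ < ‖σ₂ θ‖`) have real conjugate in the dyadic range `t ≤ σ₁ θ < 2t`.
Proof: two such minima `θ ≠ θ'` have `‖σ₂ θ - σ₂ θ'‖ ≥ max (‖σ₂ θ‖, ‖σ₂ θ'‖)` (a), hence make an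
angle `≥ 60°` at `0` (b), hence have different sector indices `⌈3 arg (σ₂ ·) / π⌉ ∈ {-2, …, 3}` (c);
an injection into a six-element set bounds `encard` by `6`. -/
theorem stub_packing : ∀ (K : Type) [Field K] (σ₁ : K →+* ℝ) (σ₂ : K →+* ℂ) (L : AddSubgroup K) (t : ℝ),
    0 < t → Set.encard {θ : K | θ ∈ L ∧ θ ≠ 0 ∧
      (∀ φ ∈ L, φ ≠ 0 → |σ₁ φ| < |σ₁ θ| → ‖σ₂ θ‖ ≤ ‖σ₂ φ‖) ∧ t ≤ σ₁ θ ∧ σ₁ θ < 2 * t} ≤ 6 := by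
  intro K _ σ₁ σ₂ L t _
  refine (Set.encard_le_encard_of_injOn (f := fun θ : K => ⌈3 * arg (σ₂ θ) / π⌉)
    (t := ((Finset.Icc (-2 : ℤ) 3 : Finset ℤ) : Set ℤ)) ?_ ?_).trans ?_
  · intro θ _
    simpa only [Finset.coe_Icc, Set.mem_Icc] using stub_packing_sector_mem (σ₂ θ)
  · rintro θ ⟨hθL, hθ0, hmin, ht, ht2⟩ θ' ⟨hθ'L, hθ'0, hmin', ht', ht2'⟩ h
    by_contra hne
    have ha := stub_packing_norm_le_norm_sub σ₁ σ₂ L t hθL hmin ht ht2 hθ'L ht' ht2' hne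
    have ha' := stub_packing_norm_le_norm_sub σ₁ σ₂ L t hθ'L hmin' ht' ht2' hθL ht ht2 (Ne.symm hne)
    rw [norm_sub_rev] at ha'
    have hb := stub_packing_two_mul_re_le ha ha'
    have hc := stub_packing_lt_two_mul_re ((map_ne_zero σ₂).mpr hθ0) ((map_ne_zero σ₂).mpr hθ'0) h
    linarith
  · rw [Set.encard_coe_eq_coe_finsetCard, Int.card_Icc]
    norm_num

end Summit.QuantumAdvantage.QuantumAdvantage.Theorems.LinnikCubicClassGroups
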